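import Summits.CriticalPhenomena.PercolationContinuityZ3.Theorems.PercNearOneGluingNoHeavyLowerTailAntitheticTwoStageSide
import Summits.CriticalPhenomena.PercolationContinuityZ3.Theorems.PercNearOneGluingNoHeavyLowerTailAntitheticTwoStageInner
import Summits.CriticalPhenomena.PercolationContinuityZ3.Theorems.PercNearOneGluingNoHeavyLowerTailAntitheticCutVertex
import Summits.CriticalPhenomena.PercolationContinuityZ3.Theorems.PercNearOneGluingNoHeavyLowerTailAntitheticDegTwoChange
import HarnessLib

/-!
# `NoHeavyLowerTail` (stmt-CriticalPhenomena-4575) — antithetic cluster pairs: the TWO-STAGE HARRIS THEOREM 2H, graph side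
# (HOME/THEOREM-FAT.md, prim-hp-2 gen 59)

Support file (`--supports stmt-CriticalPhenomena-4575`, hull-port prover `prim-hp-2`, gen 59).  No definitions, no named facts, no sorries;
standard axioms.  VERTEX version.

SETTING as …AntitheticCutVertex (THEOREM OS⊕-C): two edge sets `E₁, E₂` on disjoint vertex sets `U₁, U₂` glued at the source `s`, `y ∈ U₁`,
`z ∈ U₂`, a bonus vertex `x`; `Xᵢ(ω) = openCluster (ω ∩ Eᵢ) s`, `Yᵢ(ω) = openCluster (ωᶜ ∩ Eᵢ) s`.

**THEOREM 2H** (`Antithetic.TwoStage.change_nonneg`).  Assume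
 (H1) `sy ∈ E₁` and side 1 is NESTED-UP at `y`: `sy` red and `y ∉ Y₁ ω` imply `Y₁ ω ⊆ X₁ ω` (every `{s,y} * H₁`);
 (H2) side 2 is R-ASSOCIATED: Harris' inequality holds on `{ω₂ : z ∉ Y₂ ω₂}` for twisted-monotone functions of the pair `(X₂, Y₂)` (every fan
      `s * K_{1,k}` at its hub; by census every rooted cone on ≤ 6 vertices).
Then for all monotone `F, G` the CHANGE sum of deg-2 elimination over `E₁ ∪ E₂`,
  `Σ_{ω : ¬(y ∈ X ω ∧ z ∈ Y ω)} (F(X ω ∪ {x}·[y ∈ X ω]) − F(Y ω ∪ {x}·[z ∈ Y ω]))(G(…) − G(…))`, is `≥ 0`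
(`X, Y` the clusters of `E₁ ∪ E₂`).  With `Antithetic.DegTwo.deg2_vertex_of_change` this is the vertex antithetic inequality at `R = {x}` for
`G = (E₁ ∪ E₂) + xy + xz` (`Antithetic.TwoStage.vertex_sum_nonneg`) — THEOREM FAT for FAT(k₁,k₂) once (H2) is supplied for the fan.
Proof: grafting (the CHANGE sum is the diagonal of a double sum over pairs of colourings, `Cut.graft_graft`), `TwoStage.inner_bound` (inner Harris
over side 2, (H2)), `TwoStage.constraint_chain` (the chain (𝒞)), and `TwoStage.side_sum_nonneg` with Harris on the red-pinned cube `{sy red}`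
(`TwoStage.pinned_cube_sum_nonneg` of …AntitheticDegTwoChange) and (H1).
[cite: VandenbergHaggstromKahn2005, §1 p. 6 ("Harris' inequality"), §1 p. 3 (open cluster `C_s`)]
-/

noncomputable section

namespace Summit.CriticalPhenomena.PercolationContinuityZ3.Theorems

open Literature.Probability.Percolation
open scoped Classical symmDiff

namespace Antithetic

namespace TwoStage

variable {V : Type*} [Fintype V]

/-- **THEOREM 2H** (HOME/THEOREM-FAT.md): CHANGE ≥ 0 over a cut composite with (H1) on the `y`-side and (H2) on the `z`-side. [this work] -/
theorem change_nonneg (E₁ E₂ : Set (Sym2 V)) (s y z x : V) (U₁ U₂ : Set V) (hU : Disjoint U₁ U₂) (hs₁ : s ∉ U₁)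
    (hs₂ : s ∉ U₂) (hE₁ : ∀ e ∈ E₁, ∀ v ∈ e, v = s ∨ v ∈ U₁) (hE₂ : ∀ e ∈ E₂, ∀ v ∈ e, v = s ∨ v ∈ U₂)
    (hdis : Disjoint E₁ E₂) (hy : y ∈ U₁) (hz : z ∈ U₂) (hsy : s(s, y) ∈ E₁)
    (hnest : ∀ ω : Set (Sym2 V), s(s, y) ∈ ω → y ∉ openCluster (ωᶜ ∩ E₁) s → openCluster (ωᶜ ∩ E₁) s ⊆ openCluster (ω ∩ E₁) s)
    (hR : ∀ Φ₁ Φ₂ : Set V → Set V → ℝ,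
      (∀ ⦃A A' B B' : Set V⦄, A ⊆ A' → B' ⊆ B → Φ₁ A B ≤ Φ₁ A' B') → (∀ ⦃A A' B B' : Set V⦄, A ⊆ A' → B' ⊆ B → Φ₂ A B ≤ Φ₂ A' B') →
      (∑ T ∈ Finset.univ.filter (fun T : Set (Sym2 V) => z ∉ openCluster (Tᶜ ∩ E₂) s),
          Φ₁ (openCluster (T ∩ E₂) s) (openCluster (Tᶜ ∩ E₂) s)) *
        (∑ T ∈ Finset.univ.filter (fun T : Set (Sym2 V) => z ∉ openCluster (Tᶜ ∩ E₂) s),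
          Φ₂ (openCluster (T ∩ E₂) s) (openCluster (Tᶜ ∩ E₂) s)) ≤
      ((Finset.univ.filter fun T : Set (Sym2 V) => z ∉ openCluster (Tᶜ ∩ E₂) s).card : ℝ) *
        ∑ T ∈ Finset.univ.filter (fun T : Set (Sym2 V) => z ∉ openCluster (Tᶜ ∩ E₂) s),
          Φ₁ (openCluster (T ∩ E₂) s) (openCluster (Tᶜ ∩ E₂) s) * Φ₂ (openCluster (T ∩ E₂) s) (openCluster (Tᶜ ∩ E₂) s))
    {F G : Set V → ℝ} (hF : Monotone F) (hG : Monotone G) :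
    0 ≤ ∑ ω ∈ Finset.univ.filter (fun ω : Set (Sym2 V) =>
        ¬ ((openGraph (ω ∩ (E₁ ∪ E₂))).Reachable s y ∧ (openGraph (ωᶜ ∩ (E₁ ∪ E₂))).Reachable s z)),
      (F (openCluster (ω ∩ (E₁ ∪ E₂)) s ∪ {v | v ∈ ({x} : Set V) ∧ y ∈ openCluster (ω ∩ (E₁ ∪ E₂)) s}) -
          F (openCluster (ωᶜ ∩ (E₁ ∪ E₂)) s ∪ {v | v ∈ ({x} : Set V) ∧ z ∈ openCluster (ωᶜ ∩ (E₁ ∪ E₂)) s})) *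
        (G (openCluster (ω ∩ (E₁ ∪ E₂)) s ∪ {v | v ∈ ({x} : Set V) ∧ y ∈ openCluster (ω ∩ (E₁ ∪ E₂)) s}) -
          G (openCluster (ωᶜ ∩ (E₁ ∪ E₂)) s ∪ {v | v ∈ ({x} : Set V) ∧ z ∈ openCluster (ωᶜ ∩ (E₁ ∪ E₂)) s})) := by
  -- notation
  let X₁ : Set (Sym2 V) → Set V := fun ω => openCluster (ω ∩ E₁) s
  let Y₁ : Set (Sym2 V) → Set V := fun ω => openCluster (ωᶜ ∩ E₁) s
  let X₂ : Set (Sym2 V) → Set V := fun ω => openCluster (ω ∩ E₂) s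
  let Y₂ : Set (Sym2 V) → Set V := fun ω => openCluster (ωᶜ ∩ E₂) s
  let h₁ : Set V → Set V → ℝ := fun P Q => F P - F Q
  let h₂ : Set V → Set V → ℝ := fun P Q => G P - G Q
  have hh₁ : ∀ ⦃A A' B B' : Set V⦄, A ⊆ A' → B' ⊆ B → h₁ A B ≤ h₁ A' B' := fun A A' B B' hA hB => sub_le_sub (hF hA) (hF hB)
  have hh₂ : ∀ ⦃A A' B B' : Set V⦄, A ⊆ A' → B' ⊆ B → h₂ A B ≤ h₂ A' B' := fun A A' B B' hA hB => sub_le_sub (hG hA) (hG hB)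
  have hodd₁ : ∀ A B, h₁ B A = -h₁ A B := fun A B => by show F B - F A = -(F A - F B); ring
  have hodd₂ : ∀ A B, h₂ B A = -h₂ A B := fun A B => by show G B - G A = -(G A - G B); ring
  let Ψ₂ : Set (Sym2 V) → Set (Sym2 V) → ℝ := fun ω₁ ω₂ =>
    if ¬ (y ∈ X₁ ω₁ ∧ z ∈ Y₂ ω₂) then
      h₁ (X₁ ω₁ ∪ X₂ ω₂ ∪ {v | v ∈ ({x} : Set V) ∧ y ∈ X₁ ω₁}) (Y₁ ω₁ ∪ Y₂ ω₂ ∪ {v | v ∈ ({x} : Set V) ∧ z ∈ Y₂ ω₂}) *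
        h₂ (X₁ ω₁ ∪ X₂ ω₂ ∪ {v | v ∈ ({x} : Set V) ∧ y ∈ X₁ ω₁}) (Y₁ ω₁ ∪ Y₂ ω₂ ∪ {v | v ∈ ({x} : Set V) ∧ z ∈ Y₂ ω₂})
    else 0
  have hdis' : ∀ e, e ∈ E₁ → e ∉ E₂ := fun e h1 h2 => Set.disjoint_left.1 hdis h1 h2
  -- (1) the target is the diagonal of `Ψ₂`
  have hdiag : ∑ ω ∈ Finset.univ.filter (fun ω : Set (Sym2 V) =>
        ¬ ((openGraph (ω ∩ (E₁ ∪ E₂))).Reachable s y ∧ (openGraph (ωᶜ ∩ (E₁ ∪ E₂))).Reachable s z)),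
      (F (openCluster (ω ∩ (E₁ ∪ E₂)) s ∪ {v | v ∈ ({x} : Set V) ∧ y ∈ openCluster (ω ∩ (E₁ ∪ E₂)) s}) -
          F (openCluster (ωᶜ ∩ (E₁ ∪ E₂)) s ∪ {v | v ∈ ({x} : Set V) ∧ z ∈ openCluster (ωᶜ ∩ (E₁ ∪ E₂)) s})) *
        (G (openCluster (ω ∩ (E₁ ∪ E₂)) s ∪ {v | v ∈ ({x} : Set V) ∧ y ∈ openCluster (ω ∩ (E₁ ∪ E₂)) s}) -
          G (openCluster (ωᶜ ∩ (E₁ ∪ E₂)) s ∪ {v | v ∈ ({x} : Set V) ∧ z ∈ openCluster (ωᶜ ∩ (E₁ ∪ E₂)) s})) = ∑ ω, Ψ₂ ω ω := by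
    rw [Finset.sum_filter]
    refine Finset.sum_congr rfl fun ω _ => ?_
    have e1 : openCluster (ω ∩ (E₁ ∪ E₂)) s = X₁ ω ∪ X₂ ω := Cut.cluster_union hU hs₁ hs₂ hE₁ hE₂ ω
    have e2 : openCluster (ωᶜ ∩ (E₁ ∪ E₂)) s = Y₁ ω ∪ Y₂ ω := Cut.cluster_union hU hs₁ hs₂ hE₁ hE₂ ωᶜ
    have c1 : (openGraph (ω ∩ (E₁ ∪ E₂))).Reachable s y ↔ y ∈ X₁ ω := by
      change y ∈ openCluster (ω ∩ (E₁ ∪ E₂)) s ↔ _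
      rw [e1, Set.mem_union]
      exact ⟨fun h => h.resolve_right (Cut.not_mem_cluster_other hU hs₁ hE₂ hy ω), Or.inl⟩
    have c2 : (openGraph (ωᶜ ∩ (E₁ ∪ E₂))).Reachable s z ↔ z ∈ Y₂ ω := by
      change z ∈ openCluster (ωᶜ ∩ (E₁ ∪ E₂)) s ↔ _
      rw [e2, Set.mem_union]
      exact ⟨fun h => h.resolve_left (Cut.not_mem_cluster_other hU.symm hs₂ hE₁ hz ωᶜ), Or.inr⟩
    have c1' : (y ∈ openCluster (ω ∩ (E₁ ∪ E₂)) s) = (y ∈ X₁ ω) := propext c1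
    have c2' : (z ∈ openCluster (ωᶜ ∩ (E₁ ∪ E₂)) s) = (z ∈ Y₂ ω) := propext c2
    have sx1 : {v | v ∈ ({x} : Set V) ∧ y ∈ openCluster (ω ∩ (E₁ ∪ E₂)) s} = {v | v ∈ ({x} : Set V) ∧ y ∈ X₁ ω} := by rw [c1']
    have sx2 : {v | v ∈ ({x} : Set V) ∧ z ∈ openCluster (ωᶜ ∩ (E₁ ∪ E₂)) s} = {v | v ∈ ({x} : Set V) ∧ z ∈ Y₂ ω} := by rw [c2']
    rw [sx1, sx2, e1, e2]
    show (if ¬ ((openGraph (ω ∩ (E₁ ∪ E₂))).Reachable s y ∧ (openGraph (ωᶜ ∩ (E₁ ∪ E₂))).Reachable s z) then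
        h₁ (X₁ ω ∪ X₂ ω ∪ {v | v ∈ ({x} : Set V) ∧ y ∈ X₁ ω}) (Y₁ ω ∪ Y₂ ω ∪ {v | v ∈ ({x} : Set V) ∧ z ∈ Y₂ ω}) *
          h₂ (X₁ ω ∪ X₂ ω ∪ {v | v ∈ ({x} : Set V) ∧ y ∈ X₁ ω}) (Y₁ ω ∪ Y₂ ω ∪ {v | v ∈ ({x} : Set V) ∧ z ∈ Y₂ ω}) else 0) =
      if ¬ (y ∈ X₁ ω ∧ z ∈ Y₂ ω) then
        h₁ (X₁ ω ∪ X₂ ω ∪ {v | v ∈ ({x} : Set V) ∧ y ∈ X₁ ω}) (Y₁ ω ∪ Y₂ ω ∪ {v | v ∈ ({x} : Set V) ∧ z ∈ Y₂ ω}) *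
          h₂ (X₁ ω ∪ X₂ ω ∪ {v | v ∈ ({x} : Set V) ∧ y ∈ X₁ ω}) (Y₁ ω ∪ Y₂ ω ∪ {v | v ∈ ({x} : Set V) ∧ z ∈ Y₂ ω}) else 0
    rw [c1, c2]
  -- (2) grafting: the double sum is `|Set (Sym2 V)|` times the diagonal
  let θ : Set (Sym2 V) × Set (Sym2 V) → Set (Sym2 V) × Set (Sym2 V) :=
    fun p => ((p.1 \ E₂) ∪ (p.2 ∩ E₂), (p.2 \ E₂) ∪ (p.1 ∩ E₂))
  have hθ : Function.Involutive θ := fun p => Cut.graft_graft E₂ p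
  have g1 : ∀ a b : Set (Sym2 V), ((a \ E₂) ∪ (b ∩ E₂)) ∩ E₁ = a ∩ E₁ := by
    intro a b; ext e
    simp only [Set.mem_inter_iff, Set.mem_union, Set.mem_sdiff]
    constructor
    · rintro ⟨h | h, he⟩
      · exact ⟨h.1, he⟩
      · exact absurd h.2 (hdis' e he)
    · rintro ⟨ha, he⟩; exact ⟨Or.inl ⟨ha, hdis' e he⟩, he⟩
  have g2 : ∀ a b : Set (Sym2 V), ((a \ E₂) ∪ (b ∩ E₂))ᶜ ∩ E₁ = aᶜ ∩ E₁ := by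
    intro a b; ext e
    simp only [Set.mem_inter_iff, Set.mem_compl_iff, Set.mem_union, Set.mem_sdiff, not_or, not_and, not_not]
    constructor
    · rintro ⟨⟨h1, _⟩, he⟩; exact ⟨fun ha => hdis' e he (h1 ha), he⟩
    · rintro ⟨ha, he⟩; exact ⟨⟨fun ha' => absurd ha' ha, fun _ he2 => absurd he2 (hdis' e he)⟩, he⟩
  have g3 : ∀ a b : Set (Sym2 V), ((a \ E₂) ∪ (b ∩ E₂)) ∩ E₂ = b ∩ E₂ := fun a b => (Cut.graft_inter_right a b).1
  have g4 : ∀ a b : Set (Sym2 V), ((a \ E₂) ∪ (b ∩ E₂))ᶜ ∩ E₂ = bᶜ ∩ E₂ := fun a b => (Cut.graft_inter_right a b).2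
  have hΨθ : ∀ p : Set (Sym2 V) × Set (Sym2 V), Ψ₂ p.1 p.2 = Ψ₂ (θ p).1 (θ p).1 := by
    intro p
    have a1 : X₁ (θ p).1 = X₁ p.1 := by show openCluster (((p.1 \ E₂) ∪ (p.2 ∩ E₂)) ∩ E₁) s = _; rw [g1]
    have a2 : Y₁ (θ p).1 = Y₁ p.1 := by show openCluster (((p.1 \ E₂) ∪ (p.2 ∩ E₂))ᶜ ∩ E₁) s = _; rw [g2]
    have a3 : X₂ (θ p).1 = X₂ p.2 := by show openCluster (((p.1 \ E₂) ∪ (p.2 ∩ E₂)) ∩ E₂) s = _; rw [g3]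
    have a4 : Y₂ (θ p).1 = Y₂ p.2 := by show openCluster (((p.1 \ E₂) ∪ (p.2 ∩ E₂))ᶜ ∩ E₂) s = _; rw [g4]
    simp only [Ψ₂, a1, a2, a3, a4]
  have hrel : ∑ ω₁, ∑ ω₂, Ψ₂ ω₁ ω₂ = (Fintype.card (Set (Sym2 V)) : ℝ) * ∑ ω, Ψ₂ ω ω := by
    rw [← Fintype.sum_prod_type']
    rw [show ∑ p : Set (Sym2 V) × Set (Sym2 V), Ψ₂ p.1 p.2 = ∑ p : Set (Sym2 V) × Set (Sym2 V), Ψ₂ (θ p).1 (θ p).1 from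
      Fintype.sum_congr _ _ hΨθ]
    rw [Fintype.sum_bijective θ hθ.bijective (fun p => Ψ₂ (θ p).1 (θ p).1) (fun q => Ψ₂ q.1 q.1) (fun p => rfl)]
    rw [Fintype.sum_prod_type, Finset.mul_sum]
    refine Finset.sum_congr rfl fun a _ => ?_
    show ∑ _b : Set (Sym2 V), Ψ₂ a a = _
    rw [Finset.sum_const, Finset.card_univ, nsmul_eq_mul]
  -- (3) the double sum is nonnegative: inner Harris over side 2, then the side-1 inequality
  -- constants
  set U : Finset (Set (Sym2 V)) := Finset.univ.filter (fun T : Set (Sym2 V) => z ∉ Y₂ T) with hUdef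
  have hzs : z ≠ s := fun h => hs₂ (h ▸ hz)
  have hUne : (Set.univ : Set (Sym2 V)) ∈ U := by
    rw [hUdef, Finset.mem_filter]
    refine ⟨Finset.mem_univ _, ?_⟩
    show z ∉ openCluster ((Set.univ : Set (Sym2 V))ᶜ ∩ E₂) s
    rw [Set.compl_univ, Set.empty_inter]
    show ¬ (openGraph (∅ : Set (Sym2 V))).Reachable s z
    intro h
    have : (openGraph (∅ : Set (Sym2 V))) = ⊥ := by
      ext a b; simp [openGraph_adj]
    rw [this, SimpleGraph.reachable_bot] at h
    exact hzs h.symm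
  have hcRnat : 0 < U.card := Finset.card_pos.2 ⟨_, hUne⟩
  set cR : ℝ := (U.card : ℝ) with hcRdef
  set cB : ℝ := (Fintype.card (Set (Sym2 V)) : ℝ) with hcBdef
  have hcRpos : 0 < cR := by rw [hcRdef]; exact_mod_cast hcRnat
  have hcBpos : 0 < cB := by rw [hcBdef]; exact_mod_cast Fintype.card_pos
  have hcRB : cR ≤ cB := by
    rw [hcRdef, hcBdef]; exact_mod_cast (Finset.card_le_univ U)
  -- the side-2 averages (normalised)
  let Gb : (Set V → Set V → ℝ) → Set V → Set V → ℝ := fun h P Q =>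
    ∑ T : Set (Sym2 V), h (P ∪ X₂ T) (Q ∪ Y₂ T ∪ {v | v ∈ ({x} : Set V) ∧ z ∈ Y₂ T})
  let Gt : (Set V → Set V → ℝ) → Set V → Set V → ℝ := fun h P Q =>
    ∑ T ∈ U, h (P ∪ X₂ T ∪ {x}) (Q ∪ Y₂ T)
  have hX₂mono : Monotone X₂ := fun T T' h => Freeze.openCluster_mono (Set.inter_subset_inter_left E₂ h) s
  have hY₂anti : Antitone Y₂ := fun T T' h => Freeze.openCluster_mono (Set.inter_subset_inter_left E₂ (Set.compl_subset_compl.2 h)) s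
  have hXY : ∀ T, Y₂ T = X₂ Tᶜ := fun T => rfl
  have hdbl : 0 ≤ ∑ ω₁, ∑ ω₂, Ψ₂ ω₁ ω₂ := by
    -- rewrite the inner sums as filtered sums
    have hinner : ∀ ω₁, ∑ ω₂, Ψ₂ ω₁ ω₂ = ∑ T ∈ Finset.univ.filter (fun T : Set (Sym2 V) => ¬ (y ∈ X₁ ω₁ ∧ z ∈ Y₂ T)),
        h₁ (X₁ ω₁ ∪ X₂ T ∪ {v | v ∈ ({x} : Set V) ∧ y ∈ X₁ ω₁}) (Y₁ ω₁ ∪ Y₂ T ∪ {v | v ∈ ({x} : Set V) ∧ z ∈ Y₂ T}) *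
          h₂ (X₁ ω₁ ∪ X₂ T ∪ {v | v ∈ ({x} : Set V) ∧ y ∈ X₁ ω₁}) (Y₁ ω₁ ∪ Y₂ T ∪ {v | v ∈ ({x} : Set V) ∧ z ∈ Y₂ T}) := by
      intro ω₁; rw [Finset.sum_filter]
    simp_rw [hinner]
    -- inner Harris
    have hIB := inner_bound X₂ Y₂ hX₂mono hY₂anti x z X₁ Y₁ y hR hcRnat hh₁ hh₂
    -- the side-1 inequality
    have hC := fun (h : Set V → Set V → ℝ) (hh : ∀ ⦃A A' B B' : Set V⦄, A ⊆ A' → B' ⊆ B → h A B ≤ h A' B')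
      (hodd : ∀ A B, h B A = -h A B) (P Q : Set V) => constraint_chain X₂ Y₂ hX₂mono hY₂anti hXY x z hh hodd P Q
    have hside := side_sum_nonneg (V := V) (Ω := Set (Sym2 V)) compl compl_compl X₁ Y₁ (fun ω => rfl)
      (fun ω => by show openCluster (ωᶜᶜ ∩ E₁) s = openCluster (ω ∩ E₁) s; rw [compl_compl])
      (fun ω => s(s, y) ∈ ω) (fun ω => Iff.rfl) y
      (fun ω hω => Freeze.mem_cluster_of_edge (mem_openCluster_self _ _) ⟨hω, hsy⟩)
      hnest
      (fun K₁ K₂ hK₁ hso₁ hK₂ hso₂ => pinned_cube_sum_nonneg E₁ s s(s, y) hK₁ hso₁ hK₂ hso₂)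
      (fun P Q => Gb h₁ P Q / cB) (fun P Q => Gt h₁ P Q / cR) (fun P Q => Gb h₂ P Q / cB) (fun P Q => Gt h₂ P Q / cR)
      (fun A A' B B' hA hB => div_le_div_of_nonneg_right (Gb_mono X₂ Y₂ x z hh₁ hA hB) hcBpos.le)
      (fun A A' B B' hA hB => div_le_div_of_nonneg_right (Gt_mono X₂ Y₂ x z hh₁ hA hB) hcRpos.le)
      (fun A A' B B' hA hB => div_le_div_of_nonneg_right (Gb_mono X₂ Y₂ x z hh₂ hA hB) hcBpos.le)
      (fun A A' B B' hA hB => div_le_div_of_nonneg_right (Gt_mono X₂ Y₂ x z hh₂ hA hB) hcRpos.le)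
      (fun A B => by
        obtain ⟨c1, c2, c3⟩ := hC h₁ hh₁ hodd₁ A B
        rw [← hUdef, ← hcBdef, ← hcRdef] at c1 c3
        refine ⟨?_, ?_, ?_⟩
        · rw [← neg_div, div_le_div_iff₀ hcRpos hcBpos]
          show -(∑ T ∈ U, h₁ (B ∪ X₂ T ∪ {x}) (A ∪ Y₂ T)) * cB ≤
            (∑ T : Set (Sym2 V), h₁ (A ∪ X₂ T) (B ∪ Y₂ T ∪ {v | v ∈ ({x} : Set V) ∧ z ∈ Y₂ T})) * cR
          linarith
        · rw [← add_div, div_le_iff₀ hcBpos, zero_mul]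
          exact c2
        · rw [← neg_div, div_le_div_iff₀ hcBpos hcRpos]
          show -(∑ T : Set (Sym2 V), h₁ (B ∪ X₂ T) (A ∪ Y₂ T ∪ {v | v ∈ ({x} : Set V) ∧ z ∈ Y₂ T})) * cR ≤
            (∑ T ∈ U, h₁ (A ∪ X₂ T ∪ {x}) (B ∪ Y₂ T)) * cB
          linarith)
      (fun A B => by
        obtain ⟨c1, c2, c3⟩ := hC h₂ hh₂ hodd₂ A B
        rw [← hUdef, ← hcBdef, ← hcRdef] at c1 c3
        refine ⟨?_, ?_, ?_⟩
        · rw [← neg_div, div_le_div_iff₀ hcRpos hcBpos]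
          show -(∑ T ∈ U, h₂ (B ∪ X₂ T ∪ {x}) (A ∪ Y₂ T)) * cB ≤
            (∑ T : Set (Sym2 V), h₂ (A ∪ X₂ T) (B ∪ Y₂ T ∪ {v | v ∈ ({x} : Set V) ∧ z ∈ Y₂ T})) * cR
          linarith
        · rw [← add_div, div_le_iff₀ hcBpos, zero_mul]
          exact c2
        · rw [← neg_div, div_le_div_iff₀ hcBpos hcRpos]
          show -(∑ T : Set (Sym2 V), h₂ (B ∪ X₂ T) (A ∪ Y₂ T ∪ {v | v ∈ ({x} : Set V) ∧ z ∈ Y₂ T})) * cR ≤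
            (∑ T ∈ U, h₂ (A ∪ X₂ T ∪ {x}) (B ∪ Y₂ T)) * cB
          linarith)
      hcRpos.le hcRB
    -- compare the two bounds: the sets {¬red ∧ y ∉ X₁} = {y ∉ X₁}, and cB·(Gb/cB)(Gb/cB) = Gb·Gb/cB
    have hset : Finset.univ.filter (fun ω : Set (Sym2 V) => ¬ s(s, y) ∈ ω ∧ y ∉ X₁ ω) =
        Finset.univ.filter (fun ω : Set (Sym2 V) => y ∉ X₁ ω) := by
      ext ω; simp only [Finset.mem_filter, Finset.mem_univ, true_and]
      constructor
      · exact fun h => h.2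
      · intro h; exact ⟨fun hω => h (Freeze.mem_cluster_of_edge (mem_openCluster_self _ _) ⟨hω, hsy⟩), h⟩
    rw [hset] at hside
    have e1 : cB * ∑ ω ∈ Finset.univ.filter (fun ω : Set (Sym2 V) => y ∉ X₁ ω), Gb h₁ (X₁ ω) (Y₁ ω) / cB * (Gb h₂ (X₁ ω) (Y₁ ω) / cB) =
        (∑ ω ∈ Finset.univ.filter (fun ω : Set (Sym2 V) => y ∉ X₁ ω), Gb h₁ (X₁ ω) (Y₁ ω) * Gb h₂ (X₁ ω) (Y₁ ω)) / cB := by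
      rw [Finset.mul_sum, Finset.sum_div]
      refine Finset.sum_congr rfl fun ω _ => ?_
      field_simp
    have e2 : cR * ∑ ω ∈ Finset.univ.filter (fun ω : Set (Sym2 V) => y ∈ X₁ ω), Gt h₁ (X₁ ω) (Y₁ ω) / cR * (Gt h₂ (X₁ ω) (Y₁ ω) / cR) =
        (∑ ω ∈ Finset.univ.filter (fun ω : Set (Sym2 V) => y ∈ X₁ ω), Gt h₁ (X₁ ω) (Y₁ ω) * Gt h₂ (X₁ ω) (Y₁ ω)) / cR := by
      rw [Finset.mul_sum, Finset.sum_div]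
      refine Finset.sum_congr rfl fun ω _ => ?_
      field_simp
    rw [e1, e2] at hside
    exact le_trans hside hIB
  -- (4) conclude
  rw [hdiag]
  have hN : (0 : ℝ) < (Fintype.card (Set (Sym2 V)) : ℝ) := by exact_mod_cast Fintype.card_pos
  rw [hrel] at hdbl
  exact (mul_nonneg_iff_of_pos_left hN).1 hdbl

end TwoStage

namespace TwoStage

variable {V : Type*} [Fintype V] {E : Set (Sym2 V)} {s x y z : V} (hxs : x ≠ s) (hxy : x ≠ y) (hxz : x ≠ z) (hyz : y ≠ z)
  (he : s(x, y) ∈ E) (hf : s(x, z) ∈ E) (hdeg : ∀ h ∈ E, x ∈ h → h = s(x, y) ∨ h = s(x, z)) (hg : s(y, z) ∉ E)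
include hxs hxy hxz hyz he hf hdeg hg

/-- **THEOREM 2H, assembled** (HOME/THEOREM-FAT.md): `x` of degree 2 with neighbours `y ≠ z` (`yz ∉ E`); `E ∖ {xy, xz} = E₁ ∪ E₂`
glued at `s` only, sides on disjoint vertex sets `U₁ ∋ y`, `U₂ ∋ z`; (H1) `sy ∈ E₁` and side 1 nested-up at `y`; (H2) side 2 R-associated
at `z`.  Then the vertex antithetic sum over `D({x})` is nonnegative for all monotone `F, G`.  (FAT(k₁,k₂) = both sides fans.) [this work] -/
theorem vertex_sum_nonneg (E₁ E₂ : Set (Sym2 V)) (U₁ U₂ : Set V) (hE' : E \ {s(x, y), s(x, z)} = E₁ ∪ E₂)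
    (hU : Disjoint U₁ U₂) (hs₁ : s ∉ U₁) (hs₂ : s ∉ U₂) (hE₁ : ∀ e ∈ E₁, ∀ v ∈ e, v = s ∨ v ∈ U₁)
    (hE₂ : ∀ e ∈ E₂, ∀ v ∈ e, v = s ∨ v ∈ U₂) (hdis : Disjoint E₁ E₂) (hyU : y ∈ U₁) (hzU : z ∈ U₂) (hsy : s(s, y) ∈ E₁)
    (hnest : ∀ ω : Set (Sym2 V), s(s, y) ∈ ω → y ∉ openCluster (ωᶜ ∩ E₁) s → openCluster (ωᶜ ∩ E₁) s ⊆ openCluster (ω ∩ E₁) s)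
    (hR : ∀ Φ₁ Φ₂ : Set V → Set V → ℝ,
      (∀ ⦃A A' B B' : Set V⦄, A ⊆ A' → B' ⊆ B → Φ₁ A B ≤ Φ₁ A' B') → (∀ ⦃A A' B B' : Set V⦄, A ⊆ A' → B' ⊆ B → Φ₂ A B ≤ Φ₂ A' B') →
      (∑ T ∈ Finset.univ.filter (fun T : Set (Sym2 V) => z ∉ openCluster (Tᶜ ∩ E₂) s),
          Φ₁ (openCluster (T ∩ E₂) s) (openCluster (Tᶜ ∩ E₂) s)) *
        (∑ T ∈ Finset.univ.filter (fun T : Set (Sym2 V) => z ∉ openCluster (Tᶜ ∩ E₂) s),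
          Φ₂ (openCluster (T ∩ E₂) s) (openCluster (Tᶜ ∩ E₂) s)) ≤
      ((Finset.univ.filter fun T : Set (Sym2 V) => z ∉ openCluster (Tᶜ ∩ E₂) s).card : ℝ) *
        ∑ T ∈ Finset.univ.filter (fun T : Set (Sym2 V) => z ∉ openCluster (Tᶜ ∩ E₂) s),
          Φ₁ (openCluster (T ∩ E₂) s) (openCluster (Tᶜ ∩ E₂) s) * Φ₂ (openCluster (T ∩ E₂) s) (openCluster (Tᶜ ∩ E₂) s))
    {F G : Set V → ℝ} (hF : Monotone F) (hG : Monotone G) :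
    0 ≤ ∑ ω ∈ Finset.univ.filter (fun ω : Set (Sym2 V) =>
        ¬ ((openGraph (ω ∩ E)).Reachable s x ∧ (openGraph (ωᶜ ∩ E)).Reachable s x)),
      (F (openCluster (ω ∩ E) s) - F (openCluster (ωᶜ ∩ E) s)) * (G (openCluster (ω ∩ E) s) - G (openCluster (ωᶜ ∩ E) s)) := by
  refine DegTwo.deg2_vertex_of_change hxs hxy hxz hyz he hf hdeg hg hF hG ?_
  rw [hE']
  exact change_nonneg E₁ E₂ s y z x U₁ U₂ hU hs₁ hs₂ hE₁ hE₂ hdis hyU hzU hsy hnest hR hF hG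

end TwoStage

namespace TwoStage

variable {V : Type*} [Fintype V]

/-- **THEOREM 2H, mirror form** (HOME/THEOREM-FAT.md §4: "by symmetry one may swap the roles"): the same CHANGE sum (orientation: `x` joins the
red cluster through `y` and the blue cluster through `z`) is `≥ 0` when (H1) holds on the `z`-side (`sz ∈ E₂`, side 2 nested-up at `z`) and (H2)
on the `y`-side (side 1 R-associated at `y`).  Obtained from `change_nonneg` with the two sides exchanged, through the complement involution
`ω ↦ ωᶜ` (the two orientations of CHANGE have the same value). [this work] -/
theorem change_nonneg_symm (E₁ E₂ : Set (Sym2 V)) (s y z x : V) (U₁ U₂ : Set V) (hU : Disjoint U₁ U₂) (hs₁ : s ∉ U₁)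
    (hs₂ : s ∉ U₂) (hE₁ : ∀ e ∈ E₁, ∀ v ∈ e, v = s ∨ v ∈ U₁) (hE₂ : ∀ e ∈ E₂, ∀ v ∈ e, v = s ∨ v ∈ U₂)
    (hdis : Disjoint E₁ E₂) (hy : y ∈ U₁) (hz : z ∈ U₂) (hsz : s(s, z) ∈ E₂)
    (hnest : ∀ ω : Set (Sym2 V), s(s, z) ∈ ω → z ∉ openCluster (ωᶜ ∩ E₂) s → openCluster (ωᶜ ∩ E₂) s ⊆ openCluster (ω ∩ E₂) s)
    (hR : ∀ Φ₁ Φ₂ : Set V → Set V → ℝ,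
      (∀ ⦃A A' B B' : Set V⦄, A ⊆ A' → B' ⊆ B → Φ₁ A B ≤ Φ₁ A' B') → (∀ ⦃A A' B B' : Set V⦄, A ⊆ A' → B' ⊆ B → Φ₂ A B ≤ Φ₂ A' B') →
      (∑ T ∈ Finset.univ.filter (fun T : Set (Sym2 V) => y ∉ openCluster (Tᶜ ∩ E₁) s),
          Φ₁ (openCluster (T ∩ E₁) s) (openCluster (Tᶜ ∩ E₁) s)) *
        (∑ T ∈ Finset.univ.filter (fun T : Set (Sym2 V) => y ∉ openCluster (Tᶜ ∩ E₁) s),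
          Φ₂ (openCluster (T ∩ E₁) s) (openCluster (Tᶜ ∩ E₁) s)) ≤
      ((Finset.univ.filter fun T : Set (Sym2 V) => y ∉ openCluster (Tᶜ ∩ E₁) s).card : ℝ) *
        ∑ T ∈ Finset.univ.filter (fun T : Set (Sym2 V) => y ∉ openCluster (Tᶜ ∩ E₁) s),
          Φ₁ (openCluster (T ∩ E₁) s) (openCluster (Tᶜ ∩ E₁) s) * Φ₂ (openCluster (T ∩ E₁) s) (openCluster (Tᶜ ∩ E₁) s))
    {F G : Set V → ℝ} (hF : Monotone F) (hG : Monotone G) :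
    0 ≤ ∑ ω ∈ Finset.univ.filter (fun ω : Set (Sym2 V) =>
        ¬ ((openGraph (ω ∩ (E₁ ∪ E₂))).Reachable s y ∧ (openGraph (ωᶜ ∩ (E₁ ∪ E₂))).Reachable s z)),
      (F (openCluster (ω ∩ (E₁ ∪ E₂)) s ∪ {v | v ∈ ({x} : Set V) ∧ y ∈ openCluster (ω ∩ (E₁ ∪ E₂)) s}) -
          F (openCluster (ωᶜ ∩ (E₁ ∪ E₂)) s ∪ {v | v ∈ ({x} : Set V) ∧ z ∈ openCluster (ωᶜ ∩ (E₁ ∪ E₂)) s})) *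
        (G (openCluster (ω ∩ (E₁ ∪ E₂)) s ∪ {v | v ∈ ({x} : Set V) ∧ y ∈ openCluster (ω ∩ (E₁ ∪ E₂)) s}) -
          G (openCluster (ωᶜ ∩ (E₁ ∪ E₂)) s ∪ {v | v ∈ ({x} : Set V) ∧ z ∈ openCluster (ωᶜ ∩ (E₁ ∪ E₂)) s})) := by
  have h := change_nonneg E₂ E₁ s z y x U₂ U₁ hU.symm hs₂ hs₁ hE₂ hE₁ hdis.symm hz hy hsz hnest hR hF hG
  rw [Set.union_comm E₂ E₁] at h
  rw [Finset.sum_filter] at h ⊢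
  -- the summand of `h` at `ωᶜ` is the summand of the goal at `ω`
  let H : Set (Sym2 V) → ℝ := fun ω =>
    if ¬ ((openGraph (ω ∩ (E₁ ∪ E₂))).Reachable s z ∧ (openGraph (ωᶜ ∩ (E₁ ∪ E₂))).Reachable s y) then
      (F (openCluster (ω ∩ (E₁ ∪ E₂)) s ∪ {v | v ∈ ({x} : Set V) ∧ z ∈ openCluster (ω ∩ (E₁ ∪ E₂)) s}) -
          F (openCluster (ωᶜ ∩ (E₁ ∪ E₂)) s ∪ {v | v ∈ ({x} : Set V) ∧ y ∈ openCluster (ωᶜ ∩ (E₁ ∪ E₂)) s})) *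
        (G (openCluster (ω ∩ (E₁ ∪ E₂)) s ∪ {v | v ∈ ({x} : Set V) ∧ z ∈ openCluster (ω ∩ (E₁ ∪ E₂)) s}) -
          G (openCluster (ωᶜ ∩ (E₁ ∪ E₂)) s ∪ {v | v ∈ ({x} : Set V) ∧ y ∈ openCluster (ωᶜ ∩ (E₁ ∪ E₂)) s}))
    else 0
  have hH : 0 ≤ ∑ ω, H ω := h
  have hre : ∑ ω, H ωᶜ = ∑ ω, H ω :=
    Fintype.sum_equiv (Function.Involutive.toPerm (compl : Set (Sym2 V) → Set (Sym2 V)) compl_involutive)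
      (fun ω => H ωᶜ) H (fun _ => rfl)
  have key : ∀ ω : Set (Sym2 V), H ωᶜ =
      (if ¬ ((openGraph (ω ∩ (E₁ ∪ E₂))).Reachable s y ∧ (openGraph (ωᶜ ∩ (E₁ ∪ E₂))).Reachable s z) then
        (F (openCluster (ω ∩ (E₁ ∪ E₂)) s ∪ {v | v ∈ ({x} : Set V) ∧ y ∈ openCluster (ω ∩ (E₁ ∪ E₂)) s}) -
            F (openCluster (ωᶜ ∩ (E₁ ∪ E₂)) s ∪ {v | v ∈ ({x} : Set V) ∧ z ∈ openCluster (ωᶜ ∩ (E₁ ∪ E₂)) s})) *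
          (G (openCluster (ω ∩ (E₁ ∪ E₂)) s ∪ {v | v ∈ ({x} : Set V) ∧ y ∈ openCluster (ω ∩ (E₁ ∪ E₂)) s}) -
            G (openCluster (ωᶜ ∩ (E₁ ∪ E₂)) s ∪ {v | v ∈ ({x} : Set V) ∧ z ∈ openCluster (ωᶜ ∩ (E₁ ∪ E₂)) s}))
      else 0) := by
    intro ω
    show (if ¬ ((openGraph (ωᶜ ∩ (E₁ ∪ E₂))).Reachable s z ∧ (openGraph (ωᶜᶜ ∩ (E₁ ∪ E₂))).Reachable s y) then
        (F (openCluster (ωᶜ ∩ (E₁ ∪ E₂)) s ∪ {v | v ∈ ({x} : Set V) ∧ z ∈ openCluster (ωᶜ ∩ (E₁ ∪ E₂)) s}) -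
            F (openCluster (ωᶜᶜ ∩ (E₁ ∪ E₂)) s ∪ {v | v ∈ ({x} : Set V) ∧ y ∈ openCluster (ωᶜᶜ ∩ (E₁ ∪ E₂)) s})) *
          (G (openCluster (ωᶜ ∩ (E₁ ∪ E₂)) s ∪ {v | v ∈ ({x} : Set V) ∧ z ∈ openCluster (ωᶜ ∩ (E₁ ∪ E₂)) s}) -
            G (openCluster (ωᶜᶜ ∩ (E₁ ∪ E₂)) s ∪ {v | v ∈ ({x} : Set V) ∧ y ∈ openCluster (ωᶜᶜ ∩ (E₁ ∪ E₂)) s}))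
      else 0) = _
    rw [compl_compl]
    by_cases hc : (openGraph (ω ∩ (E₁ ∪ E₂))).Reachable s y ∧ (openGraph (ωᶜ ∩ (E₁ ∪ E₂))).Reachable s z
    · rw [if_neg (fun h' => h' ⟨hc.2, hc.1⟩), if_neg (fun h' => h' hc)]
    · rw [if_pos (fun h' => hc ⟨h'.2, h'.1⟩), if_pos hc]
      ring
  rw [← hre, Finset.sum_congr rfl fun ω _ => key ω] at hH
  exact hH

end TwoStage

end Antithetic

end Summit.CriticalPhenomena.PercolationContinuityZ3.Theorems
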